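import Literature.MathematicalPhysics.QuantumFieldTheory.Balaban1983to89.B9SectBGWordDeltaAQY
import Literature.MathematicalPhysics.QuantumFieldTheory.Balaban1983to89.B9SectBCodedChainR4

/-!
# Balaban [B9], Thm 3.3 p. 399 with (3.42) p. 397, (3.27) p. 395, (3.86) p. 407 at a GENERIC averaging pair `(𝔮, 𝔮s)` — the (3.42) READ ∕ WRITE
# dictionary of the G frame, the cross-entry law and the `reg_ginv ∕ gb_eq_cplx` field lemmas at the letter `GbQC` of `B9SectBGWordDeltaAQY`
# (CASCADE-K piece «K2-G», stage B1; the `G[𝔮]`-edition of `B9SectBGReadCodedY(R)` §4 and `B9SectBGFrameCodedY(R)` §1)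

T. Bałaban, *Propagators for lattice gauge theories in a background field*, Commun. Math. Phys. **99** (1985) 389–434
[`Balaban1985BackgroundPropagators`, "B9"]; [4] = T. Bałaban, *Propagators and renormalization transformations for lattice gauge theories. II*,
Commun. Math. Phys. **96** (1984) 223–250 [`Balaban1984PropagatorsII`]; [B8] = T. Bałaban, *Averaging operations for lattice gauge theories*,
Commun. Math. Phys. **98** (1985) 17–51 [`Balaban1985Averaging`].

statement-level skeleton of published theorems with citation tags; proofs where landed; nothing here is a claim about the
Yang–Mills mass gap

THE PRINTED LOCUS.  Theorem 3.3 (p. 399): *«G(U) satisfies (3.42)–(3.47)»* for `G(U) = Δ_a(U)⁻¹` (3.27), `Δ_a(U) = Δ(U) + D_U R(U) D*_U + Q*(U) a Q(U)` (3.26)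
with the averaging operation `Q(U)` of (3.11)–(3.13) p. 393 = [B8] Prop. 2 p. 26.

WHY THIS FILE (seat dag-n06-c gen 25; cell INBOX 2026-08-30 «⚑ K2-G SCOPE», stage B1).  The landed G-side dictionary reads and writes the (3.42) block of
the coded bond family `KACU P G x OA parB C37 C38` at the STRAIGHT letter `OA := GAY par parB (GpY par)` through the coded letter `GbC`.  Every proof is
generic in the bond operator: `KACU`, the readers `readG342Y_KACU ∕ writeG342Y_KACU ∕ eBlock_kernelFamilyB_of_KACU_base` and def-Y's cross readers
`OpsYRead342CrossB` take `OA` as a parameter.  This file is the SAME text at `OA := GAQY 𝔮 𝔮s par (GpY par)` and the letter `GbQC 𝔮 𝔮s par b`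
(`B9SectBGWordDeltaAQY`): ★ `GbQC_eq_conj_bondOpCoordsRY`; ★★ `readG342_GbQC_printed` ∕ ★★ `writeG342_GbQC` (the G frame's `readG342 ∕ writeG342`
fields at one member); `CrossReadQY` (the cross-entry law, rate-dependent constant) with ★ `readG342Q_base` and ★★ `crossReadQY_KACU` (the law discharged from
def-Y's cross readers, constant `cXY`); ★ `reg_ginvQ_base` ∕ ★ `gb_eq_cplxQ_pair` (fields `reg_ginv ∕ gb_eq_cplx` at one member from `word_mul_GbQC ∕
GbQC_eq_of_two_sided`).  Binders = the parents' with `(𝔮, 𝔮s)` inserted after the member `x`; at `(𝔮, 𝔮s) := (QY parB, QsY parB)` every statement IS the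
parent's (`GAQY_QY`, `GbQC_QY` — `rfl`).

HONEST SCOPE.  Dictionaries between DEFINED objects (exact bookkeeping) and one analytic reading inherited verbatim (def-Y's cross entries, [4] (2.60)–(2.61));
the (3.42) block itself is a HYPOTHESIS of every statement; nothing of [B9] asserted; count-neutral; N06 NOT discharged; nothing continuum ∕ OS ∕ mass-gap ∕
Clay.  No `sorry`, no `axiom`, no `instance`, no `notation`; `CrossReadQY` is a `Prop`-valued predicate with parameters (a displayed-law shape), not a fact.
`--supports stmt-QuantumFields-27364`.

RELATED IN THE TREE, NOT DUPLICATED: `B9SectBGReadCodedY` ∕ `B9SectBCodedChainR4` (`…GReadCodedYR`, `…GFrameCodedYR`) ∕ `B9SectBGFrameCodedY` — the `QY`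
editions (their transporter-free tools `hasMajorant_of_eq`, `hasMajorant_conj_bondOpCoordsRY`, `hasMajorant_diffLetter_*`, `cXY`, `eta_inv_eq_abs_cf` are
USED); `B9SectBGWordDeltaAQY` (stage A: the letters); `Node00.OpsYSectDQ` (def-Y: `GAQY`).
-/

noncomputable section

namespace Literature.MathematicalPhysics.QuantumFieldTheory.Balaban1983to89.B9SectBGReadCodedQY

open Literature.MathematicalPhysics.QuantumFieldTheory.Balaban1983to89.B9SectBCodedClassR (RegExtraY bg9YC)
open Literature.MathematicalPhysics.QuantumFieldTheory.Balaban1983to89.B9SectBGFrameCodedY hiding CrossReadY readG342_base crossReadY_KACU gFrame₅CodedOn stepEPos_KACU_frame_on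
  reg_ginv_base gb_eq_cplx_pair
open Literature.MathematicalPhysics.QuantumFieldTheory.Balaban1983to89.B9SectBGReadCodedY hiding readG342_GbC_printed writeG342_GbC
open Literature.MathematicalPhysics.QuantumFieldTheory.Balaban1983to89
open Literature.MathematicalPhysics.QuantumFieldTheory.Balaban1983to89.Node00 (SiteY BlkY FBondY IBondY CfgY SiteParY BondOpY BondParY UboxY shiftY cdB cdsB GpY GAQY
  deltaAQY XY deltaPrimeAY bondCoordsY bondFunCoordsY bondFunCoordsY_apply bondCoordsY_apply bondCoordsY_symm_mk)
open Literature.MathematicalPhysics.QuantumFieldTheory.Balaban1983to89.B6GlobalChartV1 (blkV1)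
open Literature.MathematicalPhysics.QuantumFieldTheory.Balaban1983to89.B6Ineq2142KLevelV1 (β)
open Literature.MathematicalPhysics.QuantumFieldTheory.Balaban1983to89.B6KLevelCensusIndexV1 (KIdx kGeo)
open Literature.MathematicalPhysics.QuantumFieldTheory.Balaban1983to89.B6RandomWalk (HasMajorant BlockSupp hasMajorant_mono Ineq261)
open Literature.MathematicalPhysics.QuantumFieldTheory.Balaban1983to89.B9Thm34Ext (toB6)
open Literature.MathematicalPhysics.QuantumFieldTheory.Balaban1983to89.B9FromB6 (EBlock)
open Literature.MathematicalPhysics.QuantumFieldTheory.Balaban1983to89.B9GeoNormsKLevelV1 (geo9K geo9K_dist_nonneg)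
open Literature.MathematicalPhysics.QuantumFieldTheory.Balaban1983to89.B9Eq39Adjoint (covD covDstar prodCfg plaqU)
open Literature.MathematicalPhysics.QuantumFieldTheory.Balaban1983to89.B9Eq352DivFormLetters (conj coordEquiv conj_apply conj_neg gradLetterF_apply gradLetterB_apply)
open Literature.MathematicalPhysics.QuantumFieldTheory.Balaban1983to89.B9Eq352GradLetters (diffLetter diffLetter_inl diffLetter_inr)
open Literature.MathematicalPhysics.QuantumFieldTheory.Balaban1983to89.B9Eq371GradLetters (bT bU)
open Literature.MathematicalPhysics.QuantumFieldTheory.Balaban1983to89.B9Eq372RemLetters (lapDDLetter)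
open Literature.MathematicalPhysics.QuantumFieldTheory.Balaban1983to89.B9Eq382V3Letters (dPrimeLetter)
open Literature.MathematicalPhysics.QuantumFieldTheory.Balaban1983to89.B9Eq376POneLetters (conjHom gradLin divLin)
open Literature.MathematicalPhysics.QuantumFieldTheory.Balaban1983to89.B9Eq386Neumann (deltaA)
open Literature.MathematicalPhysics.QuantumFieldTheory.Balaban1983to89.B9CoReadingCoords (cdBₗ cdsBₗ lapBₗ cdBₗ_apply cdsBₗ_apply lapBₗ_apply)
open Literature.MathematicalPhysics.QuantumFieldTheory.Balaban1983to89.B9PinMembersKLevelV1 (MemberY geo9Y bg9Y)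
open Literature.MathematicalPhysics.QuantumFieldTheory.Balaban1983to89.B9Eq360DeltaPrimeAY (AfldY)
open Literature.MathematicalPhysics.QuantumFieldTheory.Balaban1983to89.B9SectBGpFrameCodedYR (codingYx)
open Literature.MathematicalPhysics.QuantumFieldTheory.Balaban1983to89.B9SectBGpLettersY (GVal decY decY_base decY_prod coordC blkC expAC GopC norm_le_one_and_inv_of_mem)
open Literature.MathematicalPhysics.QuantumFieldTheory.Balaban1983to89.B9SectBL2DictionaryY (coordC_base_eq)
open Literature.MathematicalPhysics.QuantumFieldTheory.Balaban1983to89.B9SectBKerLettersY (QcC QcsC CopC)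
open Literature.MathematicalPhysics.QuantumFieldTheory.Balaban1983to89.B9SectBCodedCarrier (CCfg)
open Literature.MathematicalPhysics.QuantumFieldTheory.Balaban1983to89.B9SectBCodedReadingsUR (KACU)
open Literature.MathematicalPhysics.QuantumFieldTheory.Balaban1983to89.B9SectBGReadYR (readG342Y_KACU writeG342Y_KACU eBlock_kernelFamilyB_of_KACU_base)
open Literature.MathematicalPhysics.QuantumFieldTheory.Balaban1983to89.B9SectBGpTransferInY (eBlock_mono)
open Literature.MathematicalPhysics.QuantumFieldTheory.Balaban1983to89.B9SectBGWordDiffY (bondFunCoordsY_cdB bondFunCoordsY_cdsB_inr)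
open Literature.MathematicalPhysics.QuantumFieldTheory.Balaban1983to89.B9SectBGWordDeltaAY (bondOpCoordsRY bondOpCoordsRY_apply restrictScalars_bondOpCoordsY abC LapBC
  restrictScalars_mul')
open Literature.MathematicalPhysics.QuantumFieldTheory.Balaban1983to89.B9SectBGWordDeltaAQY (GbQC QbQC QsbQC F₂QC F₂sQC word_mul_GbQC GbQC_eq_of_two_sided)
open Literature.MathematicalPhysics.QuantumFieldTheory.Balaban1983to89.B9RWSumsReadsNbr (nbr)
open Literature.MathematicalPhysics.QuantumFieldTheory.Balaban1983to89.Node00.OpsYRead342CrossB (hasMajorant_conj_cdsB_O_of_eBlockB hasMajorant_conj_O_cdB_of_eBlockB)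

variable {d ℓ : ℕ} {hd : 1 ≤ d + 1} {hL : Odd (ℓ + 1) ∧ 1 < ℓ + 1} {b₀ b₁ : ℝ} {Mstar : ℕ}
variable {𝔸 : Type} [NormedRing 𝔸] (P : RegExtraY d ℓ hd hL b₀ b₁ Mstar 𝔸) [NormedAlgebra ℂ 𝔸] [CompleteSpace 𝔸]
variable {ι : Type} [Fintype ι]
variable (G : Subgroup 𝔸ˣ) (x : MemberY d ℓ hd hL b₀ b₁ Mstar)
  (𝔮 : CfgY 𝔸 x.toKIdx → ((FBondY x.toKIdx → 𝔸) →ₗ[ℂ] (IBondY x.toKIdx → 𝔸)))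
  (𝔮s : CfgY 𝔸 x.toKIdx → ((IBondY x.toKIdx → 𝔸) →ₗ[ℂ] (FBondY x.toKIdx → 𝔸)))
  (parS : SiteParY 𝔸 x.toKIdx) (parB : BondParY 𝔸 x.toKIdx)
  (b : Module.Basis ι ℝ 𝔸) (ιB : BlkY x.toKIdx → IBondY x.toKIdx) (C37 C38 : ℝ → CfgY 𝔸 x.toKIdx → AfldY 𝔸 x.toKIdx → Prop)
  [Fintype (geo9Y x).Site] {Rr : ℝ} {Hp : Prop}

/-! ## §1 ★★ The fields `readG342` ∕ `writeG342` of the G frame at the letters `GbQC`, `LapBC` -/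

omit [Fintype (geo9Y x).Site] in
/-- `GbQC` at a coded configuration is the transported `ℝ`-twin conjugate of `G(decY c)`. [cite: Balaban1985BackgroundPropagators, (3.27) p.395, bookkeeping] -/
theorem GbQC_eq_conj_bondOpCoordsRY (c : CCfg (CfgY 𝔸 x.toKIdx) (AfldY 𝔸 x.toKIdx)) :
    GbQC x.toKIdx 𝔮 𝔮s parS b c =
      conj b (bondOpCoordsRY x.toKIdx ((GAQY x.toKIdx 𝔮 𝔮s parS (GpY x.toKIdx parS) (decY x.toKIdx c)).restrictScalars ℝ)) := by
  rw [GbQC, restrictScalars_bondOpCoordsY]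

/-- ★★ **FIELD `readG342` OF THE G FRAME AT NODE 00's LETTERS** (at a `G`-valued base `U`; the instance destructures the coded (3.35) hypothesis to it):
the (3.42) block of `KACU G x (GAQY 𝔮 𝔮s parS (GpY parS)) parB C37 C38` at `base U` with `(B₀, δ)` gives r06's block majorants of `GbQC (base U)`, of
`conj b (diffLetter (bT shiftY) (bU (coordC (base U))) η⁻¹ k) * GbC` for the PRINTED `k = inl ν`, of `GbQC * conj b (diffLetter … k)` for the PRINTED `k = inr ν`,
and of `LapBC (base U) * GbC (base U)`, on `(κ × SiteY) × ι` with `(M₂Σ_j‖b_j‖·B₀, δ)` and the profiles `ℓ², ℓ, ℓ, 1`.  (The cross products `k = inr ν` on the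
left ∕ `k = inl ν` on the right are NOT print's (3.42) entries; they are supplied separately.)
[cite: Balaban1985BackgroundPropagators, Thm 3.3 p.399 with (3.42) p.397, Thm 3.4 p.400; Balaban1984PropagatorsII, (2.51) p.232] -/
theorem readG342_GbQC_printed (hι : ∀ s, β x.toKIdx.hN x.toKIdx.D x.toKIdx.hk (ιB s) = s)
    {M₂ : ℝ} (hM₂ : 0 ≤ M₂) (hrepr : ∀ (v : 𝔸) (j : ι), |b.repr v j| ≤ M₂ * ‖v‖) (U : CfgY 𝔸 x.toKIdx) (hUG : GVal G x.toKIdx U)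
    {B₀ δ : ℝ} (hB₀ : 0 ≤ B₀) (hE : EBlock (KACU P G x (GAQY x.toKIdx 𝔮 𝔮s parS (GpY x.toKIdx parS)) parB C37 C38) B₀ δ (.base U)) :
    HasMajorant (g := toB6 (geo9Y x) Rr Hp) (fun q : (Fin (d + 1) × SiteY x.toKIdx) × ι => blkC x.toKIdx ιB q.1.2) (GbQC x.toKIdx 𝔮 𝔮s parS b (.base U))
        (fun a a' => M₂ * (∑ j, ‖b j‖) * B₀ * (geo9Y x).len a ^ 2 * Real.exp (-(δ * (geo9Y x).dist a a'))) ∧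
      (∀ ν : Fin (d + 1), HasMajorant (g := toB6 (geo9Y x) Rr Hp) (fun q : (Fin (d + 1) × SiteY x.toKIdx) × ι => blkC x.toKIdx ιB q.1.2)
        (conj b (diffLetter (bT (shiftY x.toKIdx)) (bU (coordC G x.toKIdx (.base U))) ((((geo9Y x).eta : ℂ))⁻¹) (Sum.inl ν)) *
          GbQC x.toKIdx 𝔮 𝔮s parS b (.base U))
        (fun a a' => M₂ * (∑ j, ‖b j‖) * B₀ * (geo9Y x).len a * Real.exp (-(δ * (geo9Y x).dist a a')))) ∧
      (∀ ν : Fin (d + 1), HasMajorant (g := toB6 (geo9Y x) Rr Hp) (fun q : (Fin (d + 1) × SiteY x.toKIdx) × ι => blkC x.toKIdx ιB q.1.2)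
        (GbQC x.toKIdx 𝔮 𝔮s parS b (.base U) *
          conj b (diffLetter (bT (shiftY x.toKIdx)) (bU (coordC G x.toKIdx (.base U))) ((((geo9Y x).eta : ℂ))⁻¹) (Sum.inr ν)))
        (fun a a' => M₂ * (∑ j, ‖b j‖) * B₀ * (geo9Y x).len a * Real.exp (-(δ * (geo9Y x).dist a a')))) ∧
      HasMajorant (g := toB6 (geo9Y x) Rr Hp) (fun q : (Fin (d + 1) × SiteY x.toKIdx) × ι => blkC x.toKIdx ιB q.1.2)
        (LapBC x.toKIdx b (.base U) * GbQC x.toKIdx 𝔮 𝔮s parS b (.base U))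
        (fun a a' => M₂ * (∑ j, ‖b j‖) * B₀ * 1 * Real.exp (-(δ * (geo9Y x).dist a a'))) := by
  letI : Fintype (geo9K x.toKIdx).Site := ‹Fintype (geo9Y x).Site›
  obtain ⟨h0, h1, h2, h3⟩ := readG342Y_KACU P (Rr := Rr) (Hp := Hp) b G x (GAQY x.toKIdx 𝔮 𝔮s parS (GpY x.toKIdx parS)) parB C37 C38 ιB hι hM₂ hrepr hB₀ hE
  have hco : coordC G x.toKIdx (.base U) = UboxY x.toKIdx U := coordC_base_eq G x hUG
  have hη : ((((geo9Y x).eta : ℂ)))⁻¹ = ((|x.toKIdx.cf| : ℝ) : ℂ) := eta_inv_eq_abs_cf x.toKIdx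
  have hGb := GbQC_eq_conj_bondOpCoordsRY x 𝔮 𝔮s parS b (.base U)
  rw [decY_base] at hGb
  have hK : ∀ (w : IBondY x.toKIdx → ℝ) {T : Module.End ℝ ((Fin (d + 1) × SiteY x.toKIdx) × ι → ℝ)},
      HasMajorant (g := toB6 (geo9Y x) Rr Hp) (fun q : (Fin (d + 1) × SiteY x.toKIdx) × ι => blkC x.toKIdx ιB q.1.2) T
        (fun a a' => M₂ * (∑ j, ‖b j‖) * (B₀ * w a * Real.exp (-(δ * (geo9Y x).dist a a')))) →
      HasMajorant (g := toB6 (geo9Y x) Rr Hp) (fun q : (Fin (d + 1) × SiteY x.toKIdx) × ι => blkC x.toKIdx ιB q.1.2) T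
        (fun a a' => M₂ * (∑ j, ‖b j‖) * B₀ * w a * Real.exp (-(δ * (geo9Y x).dist a a'))) :=
    fun w T h => hasMajorant_mono _ h fun a a' => le_of_eq (by ring)
  refine ⟨?_, fun ν => ?_, fun ν => ?_, ?_⟩
  · exact hK (fun a => (geo9Y x).len a ^ 2) (hasMajorant_of_eq x.toKIdx hGb (hasMajorant_conj_bondOpCoordsRY x.toKIdx b ιB _ h0))
  · refine hK (fun a => (geo9Y x).len a) (hasMajorant_of_eq x.toKIdx (by rw [hco, hη, hGb]) ?_)
    exact hasMajorant_diffLetter_inl_mul x.toKIdx b ιB U ν _ (h1 ν)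
  · refine hK (fun a => (geo9Y x).len a) (hasMajorant_of_eq x.toKIdx (by rw [hco, hη, hGb]) ?_)
    exact hasMajorant_mul_diffLetter_inr x.toKIdx b ιB U ν _ (h2 ν)
  · have h := hasMajorant_conj_bondOpCoordsRY x.toKIdx b ιB _ h3
    refine hK (fun _ => (1 : ℝ)) (hasMajorant_of_eq x.toKIdx (T := conj b _) ?_ h)
    rw [hGb, LapBC, decY_base, ← B9Eq352DivFormLetters.conj_mul, ← bondOpCoordsRY_mul]
    rfl

/-- ★★ **FIELD `writeG342` OF THE G FRAME AT NODE 00's LETTERS**: at a (base `U`, multiplier `a`) pair with `U` `G`-valued, r06's four block majorants at the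
product (`GbQC (prod U a)`, the left products for the printed `k = inl ν`, the right products for the printed `k = inr ν`, `LapBC (base U) * GbC (prod U a)`;
difference letters and Laplacian at the BASE) with `(B, δ)` give the (3.42) block of `KACU` at the coded product with `(M₂Σ_j‖b_j‖·B, δ)` — gen 12's writer
`writeG342Y_KACU` transported. [cite: Balaban1985BackgroundPropagators, Thm 3.4 p.400 with (3.42) p.397, p.403; Balaban1984PropagatorsII, (2.51) p.232] -/
theorem writeG342_GbQC (hι : ∀ s, β x.toKIdx.hN x.toKIdx.D x.toKIdx.hk (ιB s) = s)
    {M₂ : ℝ} (hM₂ : 0 ≤ M₂) (hrepr : ∀ (v : 𝔸) (j : ι), |b.repr v j| ≤ M₂ * ‖v‖) (U : CfgY 𝔸 x.toKIdx) (hUG : GVal G x.toKIdx U)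
    (a : AfldY 𝔸 x.toKIdx) {B δ : ℝ} (hB : 0 ≤ B)
    (h0 : HasMajorant (g := toB6 (geo9Y x) Rr Hp) (fun q : (Fin (d + 1) × SiteY x.toKIdx) × ι => blkC x.toKIdx ιB q.1.2)
      (GbQC x.toKIdx 𝔮 𝔮s parS b (.prod U a)) (fun a a' => B * (geo9Y x).len a ^ 2 * Real.exp (-(δ * (geo9Y x).dist a a'))))
    (h1 : ∀ ν : Fin (d + 1), HasMajorant (g := toB6 (geo9Y x) Rr Hp) (fun q : (Fin (d + 1) × SiteY x.toKIdx) × ι => blkC x.toKIdx ιB q.1.2)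
      (conj b (diffLetter (bT (shiftY x.toKIdx)) (bU (coordC G x.toKIdx (.base U))) ((((geo9Y x).eta : ℂ))⁻¹) (Sum.inl ν)) *
        GbQC x.toKIdx 𝔮 𝔮s parS b (.prod U a))
      (fun a a' => B * (geo9Y x).len a * Real.exp (-(δ * (geo9Y x).dist a a'))))
    (h2 : ∀ ν : Fin (d + 1), HasMajorant (g := toB6 (geo9Y x) Rr Hp) (fun q : (Fin (d + 1) × SiteY x.toKIdx) × ι => blkC x.toKIdx ιB q.1.2)
      (GbQC x.toKIdx 𝔮 𝔮s parS b (.prod U a) *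
        conj b (diffLetter (bT (shiftY x.toKIdx)) (bU (coordC G x.toKIdx (.base U))) ((((geo9Y x).eta : ℂ))⁻¹) (Sum.inr ν)))
      (fun a a' => B * (geo9Y x).len a * Real.exp (-(δ * (geo9Y x).dist a a'))))
    (h3 : HasMajorant (g := toB6 (geo9Y x) Rr Hp) (fun q : (Fin (d + 1) × SiteY x.toKIdx) × ι => blkC x.toKIdx ιB q.1.2)
      (LapBC x.toKIdx b (.base U) * GbQC x.toKIdx 𝔮 𝔮s parS b (.prod U a)) (fun a a' => B * 1 * Real.exp (-(δ * (geo9Y x).dist a a')))) :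
    EBlock (KACU P G x (GAQY x.toKIdx 𝔮 𝔮s parS (GpY x.toKIdx parS)) parB C37 C38) (M₂ * (∑ j, ‖b j‖) * B) δ (.prod U a) := by
  letI : Fintype (geo9K x.toKIdx).Site := ‹Fintype (geo9Y x).Site›
  have hco : coordC G x.toKIdx (.base U) = UboxY x.toKIdx U := coordC_base_eq G x hUG
  have hη : ((((geo9Y x).eta : ℂ)))⁻¹ = ((|x.toKIdx.cf| : ℝ) : ℂ) := eta_inv_eq_abs_cf x.toKIdx
  set W := decY x.toKIdx (.prod U a) with hW
  have hGb := GbQC_eq_conj_bondOpCoordsRY x 𝔮 𝔮s parS b (.prod U a)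
  refine writeG342Y_KACU P (Rr := Rr) (Hp := Hp) b G x (GAQY x.toKIdx 𝔮 𝔮s parS (GpY x.toKIdx parS)) parB C37 C38 ιB hι hM₂ hrepr U a
    ((GAQY x.toKIdx 𝔮 𝔮s parS (GpY x.toKIdx parS) W).restrictScalars ℝ) (fun Λ => rfl)
    (fun ν => cdBₗ x.toKIdx U ν) (fun ν => cdsBₗ x.toKIdx U ν) (fun ν Λ => cdBₗ_apply x.toKIdx U ν Λ) (fun ν Λ => cdsBₗ_apply x.toKIdx U ν Λ)
    (lapBₗ x.toKIdx U) (fun Λ => lapBₗ_apply x.toKIdx U Λ) hB ?_ (fun ν => ?_) (fun ν => ?_) ?_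
  · exact hasMajorant_conj_of_bondOpCoordsRY x.toKIdx b ιB _ (hasMajorant_of_eq x.toKIdx hGb.symm h0)
  · refine hasMajorant_cdBₗ_comp_of x.toKIdx b ιB U ν _ (hasMajorant_of_eq x.toKIdx ?_ (h1 ν))
    rw [hco, hη, hGb]
  · refine hasMajorant_comp_cdsBₗ_of x.toKIdx b ιB U ν _ (hasMajorant_of_eq x.toKIdx ?_ (h2 ν))
    rw [hco, hη, hGb]
  · rw [← B9Eq352DivFormLetters.conj_mul]
    refine hasMajorant_conj_of_bondOpCoordsRY x.toKIdx b ιB _ (hasMajorant_of_eq x.toKIdx ?_ h3)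
    rw [hGb, LapBC, decY_base, ← B9Eq352DivFormLetters.conj_mul, ← bondOpCoordsRY_mul]

/-! ## §2 The displayed cross-entry law and the field-shaped readings at one member -/

/-- **THE CROSS (3.42) READ ENTRIES AS A NAMED LAW** (rate-dependent constant `cX δ`): at a `G`-valued base the (3.42) block of the coded bond family with
`(B₀, δ)` gives block majorants `cX δ·B₀·ℓ(a)·e^{−δd}` of the LEFT-BACKWARD products `conj b (diffLetter … (inr ν)) * GbC` and the RIGHT-FORWARD products
`GbQC * conj b (diffLetter … (inl ν))` — the entries print's (3.42) does not list (p.398 l.20–22 licence); node00-def-Y's `OpsYRead342CrossB` supplies it with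
`cX δ = O(1)·L·e^{2(d+1)δ}` (LOCATED-13). [cite: Balaban1985BackgroundPropagators, (3.42) p.397, p.398 l.20–22, (3.8) p.392] -/
def CrossReadQY (cX : ℝ → ℝ) : Prop :=
  ∀ (U : CfgY 𝔸 x.toKIdx) (B₀ δ : ℝ), 2 * ((d : ℝ) + 1) < (geo9Y x).M → GVal G x.toKIdx U → 0 ≤ B₀ → 0 < δ →
    EBlock (KACU P G x (GAQY x.toKIdx 𝔮 𝔮s parS (GpY x.toKIdx parS)) parB C37 C38) B₀ δ (.base U) →
    (∀ ν : Fin (d + 1), HasMajorant (g := toB6 (geo9Y x) Rr Hp) (fun q : (Fin (d + 1) × SiteY x.toKIdx) × ι => blkC x.toKIdx ιB q.1.2)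
        (conj b (diffLetter (bT (shiftY x.toKIdx)) (bU (coordC G x.toKIdx (.base U))) ((((geo9Y x).eta : ℂ))⁻¹) (Sum.inr ν)) *
          GbQC x.toKIdx 𝔮 𝔮s parS b (.base U))
        (fun a a' => cX δ * B₀ * (geo9Y x).len a * Real.exp (-(δ * (geo9Y x).dist a a')))) ∧
    (∀ ν : Fin (d + 1), HasMajorant (g := toB6 (geo9Y x) Rr Hp) (fun q : (Fin (d + 1) × SiteY x.toKIdx) × ι => blkC x.toKIdx ιB q.1.2)
        (GbQC x.toKIdx 𝔮 𝔮s parS b (.base U) *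
          conj b (diffLetter (bT (shiftY x.toKIdx)) (bU (coordC G x.toKIdx (.base U))) ((((geo9Y x).eta : ℂ))⁻¹) (Sum.inl ν)))
        (fun a a' => cX δ * B₀ * (geo9Y x).len a * Real.exp (-(δ * (geo9Y x).dist a a'))))

/-- ★ FIELD `readG342` AT ONE MEMBER: print's four entries (`readG342_GbC_printed`, constant `M₂Σ_j‖b_j‖`) and the cross entries (`CrossReadY`, constant `cX δ`)
under the common constant `M₂Σ_j‖b_j‖ + cX δ`. [cite: Balaban1985BackgroundPropagators, Thm 3.3 p.399 with (3.42) p.397; Balaban1984PropagatorsII, (2.51) p.232] -/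
theorem readG342Q_base (hι : ∀ s, β x.toKIdx.hN x.toKIdx.D x.toKIdx.hk (ιB s) = s) {M₂ : ℝ} (hM₂ : 0 ≤ M₂)
    (hrepr : ∀ (v : 𝔸) (j : ι), |b.repr v j| ≤ M₂ * ‖v‖) {cX : ℝ → ℝ} (hcX : ∀ δ, 0 < δ → 0 ≤ cX δ)
    (hcross : CrossReadQY P (Rr := Rr) (Hp := Hp) G x 𝔮 𝔮s parS parB b ιB C37 C38 cX) (hdM : 2 * ((d : ℝ) + 1) < (geo9Y x).M) (U : CfgY 𝔸 x.toKIdx)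
    (hUG : GVal G x.toKIdx U) {B₀ δ : ℝ} (hB₀ : 0 < B₀) (hδ : 0 < δ)
    (hE : EBlock (KACU P G x (GAQY x.toKIdx 𝔮 𝔮s parS (GpY x.toKIdx parS)) parB C37 C38) B₀ δ (.base U)) :
    HasMajorant (g := toB6 (geo9Y x) Rr Hp) (fun q : (Fin (d + 1) × SiteY x.toKIdx) × ι => blkC x.toKIdx ιB q.1.2) (GbQC x.toKIdx 𝔮 𝔮s parS b (.base U))
        (fun a a' => (M₂ * (∑ j, ‖b j‖) + cX δ) * B₀ * (geo9Y x).len a ^ 2 * Real.exp (-(δ * (geo9Y x).dist a a'))) ∧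
      (∀ k : Fin (d + 1) ⊕ Fin (d + 1), HasMajorant (g := toB6 (geo9Y x) Rr Hp) (fun q : (Fin (d + 1) × SiteY x.toKIdx) × ι => blkC x.toKIdx ιB q.1.2)
        (conj b (diffLetter (bT (shiftY x.toKIdx)) (bU (coordC G x.toKIdx (.base U))) ((((geo9Y x).eta : ℂ))⁻¹) k) * GbQC x.toKIdx 𝔮 𝔮s parS b (.base U))
        (fun a a' => (M₂ * (∑ j, ‖b j‖) + cX δ) * B₀ * (geo9Y x).len a * Real.exp (-(δ * (geo9Y x).dist a a')))) ∧
      (∀ k : Fin (d + 1) ⊕ Fin (d + 1), HasMajorant (g := toB6 (geo9Y x) Rr Hp) (fun q : (Fin (d + 1) × SiteY x.toKIdx) × ι => blkC x.toKIdx ιB q.1.2)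
        (GbQC x.toKIdx 𝔮 𝔮s parS b (.base U) * conj b (diffLetter (bT (shiftY x.toKIdx)) (bU (coordC G x.toKIdx (.base U))) ((((geo9Y x).eta : ℂ))⁻¹) k))
        (fun a a' => (M₂ * (∑ j, ‖b j‖) + cX δ) * B₀ * (geo9Y x).len a * Real.exp (-(δ * (geo9Y x).dist a a')))) ∧
      HasMajorant (g := toB6 (geo9Y x) Rr Hp) (fun q : (Fin (d + 1) × SiteY x.toKIdx) × ι => blkC x.toKIdx ιB q.1.2)
        (LapBC x.toKIdx b (.base U) * GbQC x.toKIdx 𝔮 𝔮s parS b (.base U))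
        (fun a a' => (M₂ * (∑ j, ‖b j‖) + cX δ) * B₀ * 1 * Real.exp (-(δ * (geo9Y x).dist a a'))) := by
  obtain ⟨h0, h1, h2, h3⟩ := readG342_GbQC_printed P (Rr := Rr) (Hp := Hp) G x 𝔮 𝔮s parS parB b ιB C37 C38 hι hM₂ hrepr U hUG hB₀.le hE
  obtain ⟨c1, c2⟩ := hcross U B₀ δ hdM hUG hB₀.le hδ hE
  have hMS : 0 ≤ M₂ * ∑ j, ‖b j‖ := mul_nonneg hM₂ (Finset.sum_nonneg fun j _ => norm_nonneg _)
  have hcx := hcX δ hδ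
  have hlen : ∀ a : (geo9Y x).Site, 0 ≤ (geo9Y x).len a := fun a => (B9GeoLemma21KLevelV1.geo9Y_len_pos x a).le
  have up1 : ∀ (w : (geo9Y x).Site → ℝ), (∀ a, 0 ≤ w a) → ∀ a a' : (geo9Y x).Site,
      M₂ * (∑ j, ‖b j‖) * B₀ * w a * Real.exp (-(δ * (geo9Y x).dist a a')) ≤
        (M₂ * (∑ j, ‖b j‖) + cX δ) * B₀ * w a * Real.exp (-(δ * (geo9Y x).dist a a')) := fun w hw a a' => by
    have : 0 ≤ B₀ * w a * Real.exp (-(δ * (geo9Y x).dist a a')) := mul_nonneg (mul_nonneg hB₀.le (hw a)) (Real.exp_pos _).le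
    nlinarith
  have up2 : ∀ (w : (geo9Y x).Site → ℝ), (∀ a, 0 ≤ w a) → ∀ a a' : (geo9Y x).Site,
      cX δ * B₀ * w a * Real.exp (-(δ * (geo9Y x).dist a a')) ≤
        (M₂ * (∑ j, ‖b j‖) + cX δ) * B₀ * w a * Real.exp (-(δ * (geo9Y x).dist a a')) := fun w hw a a' => by
    have : 0 ≤ B₀ * w a * Real.exp (-(δ * (geo9Y x).dist a a')) := mul_nonneg (mul_nonneg hB₀.le (hw a)) (Real.exp_pos _).le
    nlinarith
  refine ⟨hasMajorant_mono _ h0 (up1 (fun a => (geo9Y x).len a ^ 2) fun a => sq_nonneg _), fun k => ?_, fun k => ?_,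
    hasMajorant_mono _ h3 (up1 (fun _ => (1 : ℝ)) fun _ => zero_le_one)⟩
  · cases k with
    | inl ν => exact hasMajorant_mono _ (h1 ν) (up1 (fun a => (geo9Y x).len a) hlen)
    | inr ν => exact hasMajorant_mono _ (c1 ν) (up2 (fun a => (geo9Y x).len a) hlen)
  · cases k with
    | inl ν => exact hasMajorant_mono _ (c2 ν) (up2 (fun a => (geo9Y x).len a) hlen)
    | inr ν => exact hasMajorant_mono _ (h2 ν) (up1 (fun a => (geo9Y x).len a) hlen)

/-- ★★ **THE CROSS READ LAW DISCHARGED** from node00-def-Y's bond-sector cross entries (`OpsYRead342CrossB`, FILE 63: `∇*_{V,ν}∘O(V)` and `O(V)∘∇_{V,ν}` read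
from the (3.42) block with the shifted-block factor `L·e^{2(d+1)|δ|}`, resp. `m_N·M₂Σ‖b_j‖·e^{2(d+1)|δ|}`), transported to r06's carrier and letters by
`B9SectBGReadCodedY.hasMajorant_diffLetter_inr_mul ∕ hasMajorant_mul_diffLetter_inl`; displayed: `G`-valued bond variables are contractive (`hG1`), the
neighbour count `m_N`. [cite: Balaban1985BackgroundPropagators, (3.42) p.397, p.398 l.20–22, (3.3) p.390, (3.8) p.392; Balaban1984PropagatorsII, (2.51) p.232, (2.60)–(2.61) p.234] -/
theorem crossReadQY_KACU (hι : ∀ s, β x.toKIdx.hN x.toKIdx.D x.toKIdx.hk (ιB s) = s) (hG1 : ∀ u : 𝔸ˣ, u ∈ G → ‖(u : 𝔸)‖ ≤ 1) {M₂ : ℝ} (hM₂ : 0 ≤ M₂)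
    (hrepr : ∀ (v : 𝔸) (j : ι), |b.repr v j| ≤ M₂ * ‖v‖) {mN : ℕ}
    (hnbr : ∀ y' : IBondY x.toKIdx, (nbr (geo9Y x) (2 * ((d : ℝ) + 1)) y').card ≤ mN) :
    CrossReadQY P (Rr := Rr) (Hp := Hp) G x 𝔮 𝔮s parS parB b ιB C37 C38 (cXY (d := d) (ℓ := ℓ) b M₂ mN) := by
  intro U B₀ δ hdM hUG hB₀ hδ hE
  letI : Fintype (geo9K x.toKIdx).Site := ‹Fintype (geo9Y x).Site›
  have hEB : EBlock (Node00.kernelFamilyB x.toKIdx (bg9YC 𝔸 G P x) (fun U => U) (GAQY x.toKIdx 𝔮 𝔮s parS (GpY x.toKIdx parS)) parB) B₀ δ U :=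
    eBlock_kernelFamilyB_of_KACU_base P G x (GAQY x.toKIdx 𝔮 𝔮s parS (GpY x.toKIdx parS)) parB C37 C38 hE
  have hU1 : ∀ (ν : Fin (d + 1)) (s : Site (B6GlobalChartV1.PV d ℓ x.m x.K hd hL) 0),
      ‖((U ν s : 𝔸ˣ) : 𝔸)‖ ≤ 1 ∧ ‖(((U ν s)⁻¹ : 𝔸ˣ) : 𝔸)‖ ≤ 1 := fun ν s => norm_le_one_and_inv_of_mem G hG1 (hUG ν s)
  have hco : coordC G x.toKIdx (.base U) = UboxY x.toKIdx U := coordC_base_eq G x hUG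
  have hη : ((((geo9Y x).eta : ℂ)))⁻¹ = ((|x.toKIdx.cf| : ℝ) : ℂ) := eta_inv_eq_abs_cf x.toKIdx
  have hGb := GbQC_eq_conj_bondOpCoordsRY x 𝔮 𝔮s parS b (.base U)
  rw [decY_base] at hGb
  have hMS : 0 ≤ M₂ * ∑ j, ‖b j‖ := mul_nonneg hM₂ (Finset.sum_nonneg fun j _ => norm_nonneg _)
  have hlen : ∀ a : (geo9Y x).Site, 0 ≤ (geo9Y x).len a := fun a => (B9GeoLemma21KLevelV1.geo9Y_len_pos x a).le
  constructor
  · intro ν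
    have h := hasMajorant_conj_cdsB_O_of_eBlockB (Rr := Rr) (Hp := Hp) (B := bg9YC 𝔸 G P x) (U₁ := U) x.toKIdx b (fun U => U)
      (GAQY x.toKIdx 𝔮 𝔮s parS (GpY x.toKIdx parS)) parB hEB hB₀ ιB hι hM₂ hrepr hU1 hdM ν
    refine hasMajorant_mono _ (hasMajorant_of_eq x.toKIdx (by rw [hco, hη, hGb]) (hasMajorant_diffLetter_inr_mul x.toKIdx b ιB U ν _ h))
      fun a a' => ?_
    have hw : 0 ≤ B₀ * (geo9Y x).len a * Real.exp (-(δ * (geo9Y x).dist a a')) := mul_nonneg (mul_nonneg hB₀ (hlen a)) (Real.exp_pos _).le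
    show M₂ * (∑ j, ‖b j‖) * ((((ℓ + 1 : ℕ) : ℝ) * Real.exp (|δ| * (2 * ((d : ℝ) + 1))) * B₀) * (geo9Y x).len a *
        Real.exp (-(δ * (geo9Y x).dist a a'))) ≤ cXY (d := d) (ℓ := ℓ) b M₂ mN δ * B₀ * (geo9Y x).len a * Real.exp (-(δ * (geo9Y x).dist a a'))
    unfold cXY
    have h1 : (((ℓ + 1 : ℕ) : ℝ)) ≤ (((ℓ + 1 : ℕ) : ℝ)) + (mN : ℝ) * (M₂ * ∑ j, ‖b j‖) := le_add_of_nonneg_right (by positivity)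
    have h2 : 0 ≤ M₂ * (∑ j, ‖b j‖) * Real.exp (|δ| * (2 * ((d : ℝ) + 1))) * (B₀ * (geo9Y x).len a * Real.exp (-(δ * (geo9Y x).dist a a'))) :=
      mul_nonneg (mul_nonneg hMS (Real.exp_pos _).le) hw
    nlinarith
  · intro ν
    have h := hasMajorant_conj_O_cdB_of_eBlockB (Rr := Rr) (Hp := Hp) (B := bg9YC 𝔸 G P x) (U₁ := U) x.toKIdx b (fun U => U)
      (GAQY x.toKIdx 𝔮 𝔮s parS (GpY x.toKIdx parS)) parB hEB hB₀ ιB hι hM₂ hrepr hU1 hnbr ν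
    refine hasMajorant_mono _ (hasMajorant_of_eq x.toKIdx (by rw [hco, hη, hGb]) (hasMajorant_mul_diffLetter_inl x.toKIdx b ιB U ν _ h))
      fun a a' => ?_
    show M₂ * (∑ j, ‖b j‖) * ((((mN : ℝ) * (M₂ * ∑ j, ‖b j‖) * Real.exp (|δ| * (2 * ((d : ℝ) + 1)))) * B₀) * (geo9Y x).len a *
        Real.exp (-(δ * (geo9Y x).dist a a'))) ≤ cXY (d := d) (ℓ := ℓ) b M₂ mN δ * B₀ * (geo9Y x).len a * Real.exp (-(δ * (geo9Y x).dist a a'))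
    unfold cXY
    have h1 : (mN : ℝ) * (M₂ * ∑ j, ‖b j‖) ≤ (((ℓ + 1 : ℕ) : ℝ)) + (mN : ℝ) * (M₂ * ∑ j, ‖b j‖) := le_add_of_nonneg_left (by positivity)
    have hw : 0 ≤ B₀ * (geo9Y x).len a * Real.exp (-(δ * (geo9Y x).dist a a')) := mul_nonneg (mul_nonneg hB₀ (hlen a)) (Real.exp_pos _).le
    have h2 : 0 ≤ M₂ * (∑ j, ‖b j‖) * Real.exp (|δ| * (2 * ((d : ℝ) + 1))) * (B₀ * (geo9Y x).len a * Real.exp (-(δ * (geo9Y x).dist a a'))) :=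
      mul_nonneg (mul_nonneg hMS (Real.exp_pos _).le) hw
    nlinarith

omit [Fintype (geo9Y x).Site] in
/-- ★ FIELD `reg_ginv` AT ONE MEMBER, field-shaped: at a `G`-valued base where `Δ_a[𝔮](U)` is a unit, the frame's word (coordinates `coordC`, constant `η⁻¹`)
times `GbQC` is `1` on both sides. [cite: Balaban1985BackgroundPropagators, (3.27) p.395, Thm 3.3 p.399] -/
theorem reg_ginvQ_base (U : CfgY 𝔸 x.toKIdx) (hUG : GVal G x.toKIdx U) (hunit : IsUnit (deltaAQY x.toKIdx 𝔮 𝔮s parS (GpY x.toKIdx parS) U)) :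
    deltaA (conj b (lapDDLetter (shiftY x.toKIdx) ((((geo9Y x).eta : ℂ))⁻¹) (coordC G x.toKIdx (.base U))))
        (conj b (dPrimeLetter (shiftY x.toKIdx) (coordC G x.toKIdx (.base U)) (geo9Y x).eta))
        (conjHom b (gradLin (shiftY x.toKIdx) ((((geo9Y x).eta : ℂ))⁻¹) (coordC G x.toKIdx (.base U))) ∘ₗ
            (1 - (GopC x.toKIdx parS b (.base U) ∘ₗ QcsC x.toKIdx parS b (.base U) ∘ₗ CopC x.toKIdx parS b (.base U) ∘ₗ QcC x.toKIdx parS b (.base U) ∘ₗ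
              GopC x.toKIdx parS b (.base U))) ∘ₗ
          conjHom b (divLin (shiftY x.toKIdx) ((((geo9Y x).eta : ℂ))⁻¹) (coordC G x.toKIdx (.base U))))
        (QsbQC x.toKIdx 𝔮s b (.base U)) (abC x.toKIdx b) (QbQC x.toKIdx 𝔮 b (.base U)) * GbQC x.toKIdx 𝔮 𝔮s parS b (.base U) = 1 ∧
    GbQC x.toKIdx 𝔮 𝔮s parS b (.base U) *
      deltaA (conj b (lapDDLetter (shiftY x.toKIdx) ((((geo9Y x).eta : ℂ))⁻¹) (coordC G x.toKIdx (.base U))))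
        (conj b (dPrimeLetter (shiftY x.toKIdx) (coordC G x.toKIdx (.base U)) (geo9Y x).eta))
        (conjHom b (gradLin (shiftY x.toKIdx) ((((geo9Y x).eta : ℂ))⁻¹) (coordC G x.toKIdx (.base U))) ∘ₗ
            (1 - (GopC x.toKIdx parS b (.base U) ∘ₗ QcsC x.toKIdx parS b (.base U) ∘ₗ CopC x.toKIdx parS b (.base U) ∘ₗ QcC x.toKIdx parS b (.base U) ∘ₗ
              GopC x.toKIdx parS b (.base U))) ∘ₗ
          conjHom b (divLin (shiftY x.toKIdx) ((((geo9Y x).eta : ℂ))⁻¹) (coordC G x.toKIdx (.base U))))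
        (QsbQC x.toKIdx 𝔮s b (.base U)) (abC x.toKIdx b) (QbQC x.toKIdx 𝔮 b (.base U)) = 1 := by
  have hη : ((((geo9Y x).eta : ℂ)))⁻¹ = ((|x.toKIdx.cf| : ℝ) : ℂ) := eta_inv_eq_abs_cf x.toKIdx
  rw [coordC_base_eq G x hUG, hη]
  have h := word_mul_GbQC x.toKIdx 𝔮 𝔮s parS b (.base U) (by rw [decY_base]; exact hunit)
  rw [decY_base] at h
  exact h

omit [Fintype (geo9Y x).Site] in
/-- ★ FIELD `gb_eq_cplx` AT ONE MEMBER, field-shaped: at a (base `U`, multiplier `a`) pair with `U` `G`-valued, any two-sided inverse `X` of the frame's word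
at the product field `prodCfg (coordC (base U)) η (expAC (base U) (mult a))` with the letters at `prod U a` IS `GbQC (prod U a)`.
[cite: Balaban1985BackgroundPropagators, (3.27) p.395, (3.86) p.407] -/
theorem gb_eq_cplxQ_pair (U : CfgY 𝔸 x.toKIdx) (hUG : GVal G x.toKIdx U) (a : AfldY 𝔸 x.toKIdx) (X : Module.End ℝ ((Fin (d + 1) × SiteY x.toKIdx) × ι → ℝ))
    (h1 : deltaA (conj b (lapDDLetter (shiftY x.toKIdx) ((((geo9Y x).eta : ℂ))⁻¹)
          (prodCfg (coordC G x.toKIdx (.base U)) (geo9Y x).eta (expAC x.toKIdx (.base U) (.mult a)))))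
        (conj b (dPrimeLetter (shiftY x.toKIdx) (prodCfg (coordC G x.toKIdx (.base U)) (geo9Y x).eta (expAC x.toKIdx (.base U) (.mult a))) (geo9Y x).eta))
        (conjHom b (gradLin (shiftY x.toKIdx) ((((geo9Y x).eta : ℂ))⁻¹)
              (prodCfg (coordC G x.toKIdx (.base U)) (geo9Y x).eta (expAC x.toKIdx (.base U) (.mult a)))) ∘ₗ
            (1 - (GopC x.toKIdx parS b (.prod U a) ∘ₗ QcsC x.toKIdx parS b (.prod U a) ∘ₗ CopC x.toKIdx parS b (.prod U a) ∘ₗ QcC x.toKIdx parS b (.prod U a) ∘ₗ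
              GopC x.toKIdx parS b (.prod U a))) ∘ₗ
          conjHom b (divLin (shiftY x.toKIdx) ((((geo9Y x).eta : ℂ))⁻¹)
              (prodCfg (coordC G x.toKIdx (.base U)) (geo9Y x).eta (expAC x.toKIdx (.base U) (.mult a)))))
        (QsbQC x.toKIdx 𝔮s b (.prod U a)) (abC x.toKIdx b) (QbQC x.toKIdx 𝔮 b (.prod U a)) * X = 1)
    (h2 : X * deltaA (conj b (lapDDLetter (shiftY x.toKIdx) ((((geo9Y x).eta : ℂ))⁻¹)
          (prodCfg (coordC G x.toKIdx (.base U)) (geo9Y x).eta (expAC x.toKIdx (.base U) (.mult a)))))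
        (conj b (dPrimeLetter (shiftY x.toKIdx) (prodCfg (coordC G x.toKIdx (.base U)) (geo9Y x).eta (expAC x.toKIdx (.base U) (.mult a))) (geo9Y x).eta))
        (conjHom b (gradLin (shiftY x.toKIdx) ((((geo9Y x).eta : ℂ))⁻¹)
              (prodCfg (coordC G x.toKIdx (.base U)) (geo9Y x).eta (expAC x.toKIdx (.base U) (.mult a)))) ∘ₗ
            (1 - (GopC x.toKIdx parS b (.prod U a) ∘ₗ QcsC x.toKIdx parS b (.prod U a) ∘ₗ CopC x.toKIdx parS b (.prod U a) ∘ₗ QcC x.toKIdx parS b (.prod U a) ∘ₗ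
              GopC x.toKIdx parS b (.prod U a))) ∘ₗ
          conjHom b (divLin (shiftY x.toKIdx) ((((geo9Y x).eta : ℂ))⁻¹)
              (prodCfg (coordC G x.toKIdx (.base U)) (geo9Y x).eta (expAC x.toKIdx (.base U) (.mult a)))))
        (QsbQC x.toKIdx 𝔮s b (.prod U a)) (abC x.toKIdx b) (QbQC x.toKIdx 𝔮 b (.prod U a)) = 1) :
    IsUnit (deltaAQY x.toKIdx 𝔮 𝔮s parS (GpY x.toKIdx parS) (decY x.toKIdx (.prod U a))) ∧ GbQC x.toKIdx 𝔮 𝔮s parS b (.prod U a) = X := by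
  have hη : ((((geo9Y x).eta : ℂ)))⁻¹ = ((|x.toKIdx.cf| : ℝ) : ℂ) := eta_inv_eq_abs_cf x.toKIdx
  rw [coordC_base_eq G x hUG, hη] at h1 h2
  exact GbQC_eq_of_two_sided x.toKIdx 𝔮 𝔮s parS b (.prod U a) X h1 h2

end Literature.MathematicalPhysics.QuantumFieldTheory.Balaban1983to89.B9SectBGReadCodedQY

end
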